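import Literature.Analysis.OperatorTheory.HalfLinePositiveDefiniteHolomorphic
import Mathlib.Analysis.Calculus.ParametricIntegral
import Mathlib.MeasureTheory.Integral.DominatedConvergence
import Mathlib.Analysis.SpecificLimits.Normed
import HarnessLib

/-!
# Stub `stub_laplaceGeneratingFunction` (line `Sketch`, heat cone) for the crux
`RuelleBand.ExactFirstBand` (item stmt-RiemannHypothesis-2061)

Pure measure theory / complex analysis (no zeta).  For a finite positive measure `ν` on `[0, ∞)`
and `δ > 0` put `w = e^{-δE} ∈ (0, 1]` and consider the generating function of the Laplace moments
`∫ e^{-(k+1)δE} dν(E) = ∫ w^{k+1} dν`,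

  `g(z) = ∫ w / (1 - z w) dν(E)`.

* `g` is holomorphic on `{Im z ≠ 0}`: for `Im z ≠ 0` and real `w > 0` one has
  `|1 - z w| ≥ |Im (1 - z w)| = w |Im z|`, so the integrand `w/(1 - z w)` and its `z`-derivative
  `w²/(1 - z w)²` are bounded by `|Im z|⁻¹`, `|Im z|⁻²` uniformly in `E`; differentiate under the
  integral sign (`hasDerivAt_integral_of_dominated_loc_of_deriv_le`, as in
  `Literature.Analysis.OperatorTheory.laplace_differentiableOn`).
* For `‖z‖ < 1`: a.e. `|z w| ≤ ‖z‖ < 1`, so `w/(1 - z w) = Σ_k z^k w^{k+1}` and the sum is exchanged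
  with the integral by dominated convergence (bound `Σ_k ‖z‖^k`).
-/

set_option linter.dupNamespace false

noncomputable section

open Complex MeasureTheory Filter Set
open scoped Topology

namespace Summit.RiemannHypothesis.RiemannHypothesis.Theorems.RuelleBandExactFirstBand

open Literature.Analysis.OperatorTheory

/-- `e^{-δE}` (real `δ`, `E`) is the real number `exp (-(δE))` cast to `ℂ`. [folklore] -/
theorem stub_laplaceGeneratingFunction_cexp_eq (δ E : ℝ) :
    cexp (-((δ : ℂ) * E)) = ((Real.exp (-(δ * E)) : ℝ) : ℂ) := by
  rw [Complex.ofReal_exp]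
  push_cast
  ring_nf

/-- For real `t` and complex `z`: `|Im z| · |t| ≤ ‖1 - z t‖`. [folklore] -/
theorem stub_laplaceGeneratingFunction_norm_sub_ge (z : ℂ) (t : ℝ) :
    |z.im| * |t| ≤ ‖1 - z * t‖ := by
  have h := Complex.abs_im_le_norm (1 - z * t)
  have him : (1 - z * (t : ℂ)).im = -(z.im * t) := by
    simp [Complex.mul_im]
  rw [him, abs_neg, abs_mul] at h
  exact h

/-- For real `t > 0` and `Im z ≠ 0`, `1 - z t ≠ 0`. [folklore] -/
theorem stub_laplaceGeneratingFunction_sub_ne_zero {z : ℂ} (hz : z.im ≠ 0) {t : ℝ} (ht : 0 < t) :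
    1 - z * (t : ℂ) ≠ 0 := by
  rw [← norm_pos_iff]
  refine lt_of_lt_of_le ?_ (stub_laplaceGeneratingFunction_norm_sub_ge z t)
  exact mul_pos (abs_pos.2 hz) (abs_pos.2 ht.ne')

/-- The integrand bound: `‖t/(1 - z t)‖ ≤ |Im z|⁻¹` for real `t > 0`, `Im z ≠ 0`. [folklore] -/
theorem stub_laplaceGeneratingFunction_norm_F_le {z : ℂ} (hz : z.im ≠ 0) {t : ℝ} (ht : 0 < t) :
    ‖(t : ℂ) / (1 - z * t)‖ ≤ |z.im|⁻¹ := by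
  have hzi : 0 < |z.im| := abs_pos.2 hz
  have hden : |z.im| * t ≤ ‖1 - z * (t : ℂ)‖ := by
    have := stub_laplaceGeneratingFunction_norm_sub_ge z t
    rwa [abs_of_pos ht] at this
  have hden_pos : 0 < ‖1 - z * (t : ℂ)‖ := lt_of_lt_of_le (mul_pos hzi ht) hden
  rw [norm_div, Complex.norm_real, Real.norm_of_nonneg ht.le, div_le_iff₀ hden_pos]
  calc t = |z.im|⁻¹ * (|z.im| * t) := by
        rw [← mul_assoc, inv_mul_cancel₀ hzi.ne', one_mul]
    _ ≤ |z.im|⁻¹ * ‖1 - z * (t : ℂ)‖ := by gcongr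

/-- The derivative bound: `‖t²/(1 - z t)²‖ ≤ |Im z|⁻²` for real `t > 0`, `Im z ≠ 0`. [folklore] -/
theorem stub_laplaceGeneratingFunction_norm_F'_le {z : ℂ} (hz : z.im ≠ 0) {t : ℝ} (ht : 0 < t) :
    ‖(t : ℂ) ^ 2 / (1 - z * t) ^ 2‖ ≤ |z.im|⁻¹ ^ 2 := by
  rw [← div_pow, norm_pow]
  have := stub_laplaceGeneratingFunction_norm_F_le hz ht
  gcongr

/-- The `z`-derivative of `z ↦ w/(1 - z w)` is `w²/(1 - z w)²` off the pole. [folklore] -/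
theorem stub_laplaceGeneratingFunction_hasDerivAt (w z : ℂ) (h : 1 - z * w ≠ 0) :
    HasDerivAt (fun x : ℂ => w / (1 - x * w)) (w ^ 2 / (1 - z * w) ^ 2) z := by
  have hd : HasDerivAt (fun x : ℂ => 1 - x * w) (-(1 * w)) z :=
    (hasDerivAt_id' z |>.mul_const w).const_sub 1
  refine ((hasDerivAt_const z w).div hd h).congr_deriv ?_
  ring

/-- **Part 1.** `z ↦ ∫ e^{-δE}/(1 - z e^{-δE}) dν(E)` is holomorphic off the real axis, for any finite
measure `ν` on `ℝ` and any real `δ` (differentiation under the integral sign, derivative dominated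
by `|Im z|⁻²`). [folklore] -/
theorem stub_laplaceGeneratingFunction_differentiableOn (ν : Measure ℝ) [IsFiniteMeasure ν]
    (δ : ℝ) :
    DifferentiableOn ℂ
      (fun z : ℂ => ∫ E, cexp (-((δ : ℂ) * E)) / (1 - z * cexp (-((δ : ℂ) * E))) ∂ν)
      {z : ℂ | z.im ≠ 0} := by
  intro z₀ hz₀
  have hz₀' : z₀.im ≠ 0 := hz₀
  have hz₀pos : 0 < |z₀.im| := abs_pos.2 hz₀'
  set η : ℝ := |z₀.im| / 2 with hη
  have hηpos : 0 < η := by positivity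
  set F' : ℂ → ℝ → ℂ := fun z E =>
    cexp (-((δ : ℂ) * E)) ^ 2 / (1 - z * cexp (-((δ : ℂ) * E))) ^ 2 with hF'
  have hUmem : Metric.ball z₀ η ∈ 𝓝 z₀ := Metric.ball_mem_nhds z₀ hηpos
  have hUim : ∀ z ∈ Metric.ball z₀ η, η < |z.im| := by
    intro z hz
    rw [Metric.mem_ball, dist_eq_norm] at hz
    have h1 : |(z - z₀).im| ≤ ‖z - z₀‖ := Complex.abs_im_le_norm (z - z₀)
    rw [Complex.sub_im] at h1
    have h3 := abs_sub_abs_le_abs_sub z₀.im z.im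
    rw [abs_sub_comm z₀.im z.im] at h3
    have h4 : |z₀.im| = 2 * η := by rw [hη]; ring
    linarith
  have hUne : ∀ z ∈ Metric.ball z₀ η, z.im ≠ 0 := fun z hz =>
    abs_pos.1 (hηpos.trans (hUim z hz))
  have key := hasDerivAt_integral_of_dominated_loc_of_deriv_le (μ := ν)
    (F := fun z E => cexp (-((δ : ℂ) * E)) / (1 - z * cexp (-((δ : ℂ) * E))))
    (F' := F') (x₀ := z₀) (bound := fun _ => η⁻¹ ^ 2) (s := Metric.ball z₀ η) hUmem
    (Eventually.of_forall fun z => ?_) ?_ ?_ ?_ (integrable_const _) ?_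
  · exact key.2.differentiableAt.differentiableWithinAt
  · -- measurability of the integrand
    exact (by fun_prop :
      Measurable fun E : ℝ => cexp (-((δ : ℂ) * E)) / (1 - z * cexp (-((δ : ℂ) * E)))).aestronglyMeasurable
  · -- integrability at `z₀`: bounded by `|Im z₀|⁻¹`
    refine Integrable.mono' (integrable_const (|z₀.im|⁻¹)) ?_ (Eventually.of_forall fun E => ?_)
    · exact (by fun_prop :
        Measurable fun E : ℝ => cexp (-((δ : ℂ) * E)) / (1 - z₀ * cexp (-((δ : ℂ) * E)))).aestronglyMeasurable
    · rw [stub_laplaceGeneratingFunction_cexp_eq]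
      exact stub_laplaceGeneratingFunction_norm_F_le hz₀' (Real.exp_pos _)
  · -- measurability of the derivative
    exact (by rw [hF']; fun_prop : Measurable (F' z₀)).aestronglyMeasurable
  · -- uniform bound of the derivative on the ball
    refine Eventually.of_forall fun E z hz => ?_
    rw [hF']
    dsimp only
    rw [stub_laplaceGeneratingFunction_cexp_eq]
    refine (stub_laplaceGeneratingFunction_norm_F'_le (hUne z hz) (Real.exp_pos _)).trans ?_
    have : |z.im|⁻¹ ≤ η⁻¹ := by
      rw [inv_le_inv₀ (hηpos.trans (hUim z hz)) hηpos]
      exact (hUim z hz).le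
    gcongr
  · -- differentiability of the integrand in `z`
    refine Eventually.of_forall fun E z hz => ?_
    rw [hF']
    dsimp only
    have hne : 1 - z * cexp (-((δ : ℂ) * E)) ≠ 0 := by
      rw [stub_laplaceGeneratingFunction_cexp_eq]
      exact stub_laplaceGeneratingFunction_sub_ne_zero (hUne z hz) (Real.exp_pos _)
    exact stub_laplaceGeneratingFunction_hasDerivAt _ z hne

/-- **Part 2.** For `‖z‖ < 1`, `∫ e^{-δE}/(1 - z e^{-δE}) dν(E) = Σ_k z^k ∫ e^{-(k+1)δE} dν(E)` for a
finite measure `ν` on `[0, ∞)` and `δ > 0` (geometric series under the integral sign, dominated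
convergence with bound `Σ_k ‖z‖^k`). [folklore] -/
theorem stub_laplaceGeneratingFunction_hasSum (ν : Measure ℝ) [IsFiniteMeasure ν]
    (hν : ν (Set.Iio 0) = 0) {δ : ℝ} (hδ : 0 < δ) {z : ℂ} (hz : ‖z‖ < 1) :
    HasSum (fun k : ℕ => z ^ k * ∫ E, cexp (-(((k : ℂ) + 1) * δ * E)) ∂ν)
      (∫ E, cexp (-((δ : ℂ) * E)) / (1 - z * cexp (-((δ : ℂ) * E))) ∂ν) := by
  have hgeom : Summable fun k : ℕ => ‖z‖ ^ k := summable_geometric_of_lt_one (norm_nonneg _) hz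
  have key := hasSum_integral_of_dominated_convergence (μ := ν)
    (F := fun (k : ℕ) (E : ℝ) => z ^ k * cexp (-(((k : ℂ) + 1) * δ * E)))
    (f := fun E => cexp (-((δ : ℂ) * E)) / (1 - z * cexp (-((δ : ℂ) * E))))
    (fun k _ => ‖z‖ ^ k) (fun k => by fun_prop) ?_ (Eventually.of_forall fun _ => hgeom)
    (integrable_const _) ?_
  · simpa only [integral_const_mul] using key
  · -- termwise bound `‖z^k e^{-(k+1)δE}‖ ≤ ‖z‖^k` a.e. (i.e. for `E ≥ 0`)
    intro k
    filter_upwards [ae_nonneg_of_measure_Iio hν] with E hE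
    rw [norm_mul, norm_pow]
    have hre : 0 ≤ (((k : ℂ) + 1) * δ).re := by
      have : ((k : ℂ) + 1) * δ = ((((k : ℝ) + 1) * δ : ℝ) : ℂ) := by push_cast; ring
      rw [this, Complex.ofReal_re]
      positivity
    have h1 : ‖cexp (-(((k : ℂ) + 1) * δ * E))‖ ≤ 1 := norm_cexp_neg_mul_le hre hE
    calc ‖z‖ ^ k * ‖cexp (-(((k : ℂ) + 1) * δ * E))‖ ≤ ‖z‖ ^ k * 1 := by gcongr
      _ = ‖z‖ ^ k := mul_one _
  · -- pointwise geometric series a.e.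
    filter_upwards [ae_nonneg_of_measure_Iio hν] with E hE
    have hre : 0 ≤ (δ : ℂ).re := by rw [Complex.ofReal_re]; exact hδ.le
    have hw1 : ‖cexp (-((δ : ℂ) * E))‖ ≤ 1 := norm_cexp_neg_mul_le hre hE
    have hzw : ‖z * cexp (-((δ : ℂ) * E))‖ < 1 := by
      rw [norm_mul]
      calc ‖z‖ * ‖cexp (-((δ : ℂ) * E))‖ ≤ ‖z‖ * 1 := by gcongr
        _ < 1 := by rw [mul_one]; exact hz
    have hg := (hasSum_geometric_of_norm_lt_one hzw).mul_left (cexp (-((δ : ℂ) * E)))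
    have hfun : (fun n : ℕ => cexp (-((δ : ℂ) * E)) * (z * cexp (-((δ : ℂ) * E))) ^ n) =
        fun k : ℕ => z ^ k * cexp (-(((k : ℂ) + 1) * δ * E)) := by
      funext k
      rw [mul_pow, mul_left_comm, ← pow_succ', ← Complex.exp_nat_mul]
      congr 2
      push_cast
      ring
    rw [hfun, ← div_eq_mul_inv] at hg
    exact hg

/-- **Stub `stub_laplaceGeneratingFunction`** (registered signature): the generating function
`g(z) = ∫ e^{-δE}/(1 - z e^{-δE}) dν(E)` of the Laplace moments of a finite positive measure on
`[0, ∞)` is holomorphic on `{Im z ≠ 0}` and equals `Σ_k z^k ∫ e^{-(k+1)δE} dν(E)` on `‖z‖ < 1`.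
[folklore] -/
theorem stub_laplaceGeneratingFunction :
    ∀ (ν : Measure ℝ) [IsFiniteMeasure ν], ν (Set.Iio 0) = 0 → ∀ δ : ℝ, 0 < δ →
      DifferentiableOn ℂ
        (fun z : ℂ => ∫ E, cexp (-((δ : ℂ) * E)) / (1 - z * cexp (-((δ : ℂ) * E))) ∂ν) {z : ℂ | z.im ≠ 0} ∧
      ∀ z : ℂ, ‖z‖ < 1 →
        HasSum (fun k : ℕ => z ^ k * ∫ E, cexp (-(((k : ℂ) + 1) * δ * E)) ∂ν)
          (∫ E, cexp (-((δ : ℂ) * E)) / (1 - z * cexp (-((δ : ℂ) * E))) ∂ν) := by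
  intro ν _ hν δ hδ
  exact ⟨stub_laplaceGeneratingFunction_differentiableOn ν δ,
    fun z hz => stub_laplaceGeneratingFunction_hasSum ν hν hδ hz⟩

end Summit.RiemannHypothesis.RiemannHypothesis.Theorems.RuelleBandExactFirstBand
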